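import Mathlib
import Literature.LinearAlgebra.Matrix.AdjugateKernelLine
import HarnessLib

/-!
# Route `PrintCf2`, crux stmt-BirchSwinnertonDyer-20509 `RamifiedOffTYZOfFacts` — kernel sums of singular symmetric matrices over `𝔽₂`
# (cell `bsd-print-cf2`, LEAD of 20509 g6, line `offtyz-v7`, cycle 7; kernel helper `--supports stmt-BirchSwinnertonDyer-20509`)

One linear-algebra lemma used by the kernel proof of g5's conjecture (★) `Q_n = q(κ_n)` (crux workfile
`Cruxes/RamifiedOffTYZOfFacts/Lines/offtyz_v7_QFormProof.md` §1 (1d)): Monsky's kernel sum `κ_n = Σ_{v ∈ ker M_n} v` (g5's `QForm.kappa`,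
`QForm.kerSum`) is read off the ADJUGATE of the symmetric form of `M_n`.

* `kerSum_apply_eq_adjugate` — for `M` symmetric over `𝔽₂` with `det M = 0`: `(Σ_{v : M v = 0} v)_α = adj(M)_{αα}` for every `α`.
  If the kernel is a line `{0, v₀}` the sum is `v₀` and `adj M = v₀ v₀ᵀ` (columns of the adjugate are kernel vectors; `adj M ≠ 0` for a
  one-dimensional kernel, `Literature/LinearAlgebra/Matrix/AdjugateKernelLine`; symmetry); if the kernel contains two independent vectors,
  `adj M = 0` and the sum vanishes by the fixed-point-free involution `v ↦ v + w` (`w ≠ 0` a kernel vector with `w_α = 0`).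
Pure linear algebra; no `sorry`. BSD is not proved by any of this; no class is closed.

References: [cite: HornJohnson2013, §0.8.2 (adjugate; rank of the adjugate)]; [cite: HeathBrown1994SelmerCongruentII, Appendix (Monsky), typescript p. 39 L27–L33 (the kernel of M)].
-/

namespace Summit.BirchSwinnertonDyer.PrintCf2.QFormForest

open Matrix Finset


section KerSum

variable {n : Type*} [Fintype n] [DecidableEq n]

/-- **The kernel sum of a singular symmetric matrix over `𝔽₂` is the diagonal of its adjugate**: for `Mᵀ = M`, `det M = 0`,
`(Σ_{v : M v = 0} v)_α = adj(M)_{αα}`. If the kernel is a line `{0, v₀}` the sum is `v₀` and `adj M = v₀ v₀ᵀ` (columns of the adjugate are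
kernel vectors, `adj M ≠ 0` for a one-dimensional kernel, symmetry); if the kernel contains two independent vectors, `adj M = 0` and the sum
vanishes by the fixed-point-free involution `v ↦ v + w` (`w ≠ 0` a kernel vector with `w_α = 0`). [folklore]
[cite: HornJohnson2013, §0.8.2 (adjugate of a matrix of rank n − 1 has rank 1; of rank ≤ n − 2 vanishes)] -/
theorem kerSum_apply_eq_adjugate (M : Matrix n n (ZMod 2)) (hM : Mᵀ = M) (hdet : M.det = 0) (α : n) :
    (∑ v : n → ZMod 2, if M *ᵥ v = 0 then v else 0) α = M.adjugate α α := by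
  -- the coordinate `α` of the kernel sum is the sum of `v α` over the kernel
  have hcoord : (∑ v : n → ZMod 2, if M *ᵥ v = 0 then v else 0) α =
      ∑ v ∈ (univ : Finset (n → ZMod 2)).filter (fun v => M *ᵥ v = 0), v α := by
    rw [Finset.sum_apply, sum_filter]
    exact sum_congr rfl fun v _ => by split_ifs <;> rfl
  rw [hcoord]
  obtain ⟨v₀, hv₀ne, hv₀⟩ := Matrix.exists_mulVec_eq_zero_iff.mpr hdet
  by_cases hline : ∀ w, M *ᵥ w = 0 → w = 0 ∨ w = v₀
  · -- the kernel is the line `{0, v₀}`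
    have hK : (univ : Finset (n → ZMod 2)).filter (fun v => M *ᵥ v = 0) = {0, v₀} := by
      ext w
      simp only [mem_filter, mem_univ, true_and, mem_insert, mem_singleton]
      constructor
      · exact hline w
      · rintro (rfl | rfl)
        · exact mulVec_zero M
        · exact hv₀
    rw [hK, sum_pair (Ne.symm hv₀ne), Pi.zero_apply, zero_add]
    by_cases hα : v₀ α = 0
    · rw [hα, Literature.LinearAlgebra.Matrix.adjugate_apply_eq_zero_of_mulVec M hv₀ hα hv₀ne α]
    · have hα1 : v₀ α = 1 := by
        have h : ∀ u : ZMod 2, u ≠ 0 → u = 1 := by decide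
        exact h _ hα
      rw [hα1]
      -- `adj M ≠ 0`, its columns are `0` or `v₀`, and it is symmetric
      have hadj : M.adjugate ≠ 0 := by
        refine Literature.LinearAlgebra.Matrix.adjugate_ne_zero_of_vecMul_line M v₀ (fun x hx => ?_) α
        have hx' : M *ᵥ x = 0 := by rwa [← vecMul_transpose, hM]
        rcases hline x hx' with h | h
        · exact ⟨0, by rw [h, zero_smul]⟩
        · exact ⟨1, by rw [h, one_smul]⟩
      have hcol : ∀ j, (fun i => M.adjugate i j) = 0 ∨ (fun i => M.adjugate i j) = v₀ :=
        fun j => hline _ (Literature.LinearAlgebra.Matrix.mulVec_adjugate_col M hdet j)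
      have hsymm : ∀ i j, M.adjugate i j = M.adjugate j i := by
        intro i j
        have h := congrFun (congrFun (adjugate_transpose M) j) i
        rw [transpose_apply, hM] at h
        exact h
      obtain ⟨j₀, hj₀⟩ : ∃ j₀, (fun i => M.adjugate i j₀) ≠ 0 := by
        by_contra h
        push Not at h
        exact hadj (Matrix.ext fun i j => by have := congrFun (h j) i; simpa using this)
      have hcolj₀ : (fun i => M.adjugate i j₀) = v₀ := (hcol j₀).resolve_left hj₀
      have h1 : M.adjugate α j₀ = 1 := (congrFun hcolj₀ α).trans hα1
      have hcolα : (fun i => M.adjugate i α) ≠ 0 := by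
        intro h
        have := congrFun h j₀
        simp only [Pi.zero_apply] at this
        rw [← hsymm, h1] at this
        exact one_ne_zero this
      exact ((congrFun ((hcol α).resolve_left hcolα) α).trans hα1).symm
  · -- two independent kernel vectors: `adj M = 0` and the kernel sum vanishes
    push Not at hline
    obtain ⟨w, hw, hw0, hwv⟩ := hline
    have hadj : M.adjugate = 0 := by
      refine Literature.LinearAlgebra.Matrix.adjugate_eq_zero_of_mulVec_of_mulVec M hv₀ hw ?_
      by_contra h
      push Not at h
      obtain ⟨k, hk⟩ : ∃ k, v₀ k ≠ 0 := by
        by_contra h'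
        push Not at h'
        exact hv₀ne (funext h')
      have hk1 : v₀ k = 1 := by
        have h2 : ∀ u : ZMod 2, u ≠ 0 → u = 1 := by decide
        exact h2 _ hk
      have hwk := h k
      rw [hk1, one_smul] at hwk
      rcases (by decide : ∀ u : ZMod 2, u = 0 ∨ u = 1) (w k) with h0 | h1
      · rw [h0, zero_smul] at hwk
        exact hw0 hwk.symm
      · rw [h1, one_smul] at hwk
        exact hwv hwk.symm
    rw [hadj, Matrix.zero_apply]
    -- a nonzero kernel vector `u` with `u α = 0`
    obtain ⟨u, hu, hu0, huα⟩ : ∃ u, M *ᵥ u = 0 ∧ u ≠ 0 ∧ u α = 0 := by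
      rcases (by decide : ∀ x : ZMod 2, x = 0 ∨ x = 1) (v₀ α) with h0 | h1
      · exact ⟨v₀, hv₀, hv₀ne, h0⟩
      rcases (by decide : ∀ x : ZMod 2, x = 0 ∨ x = 1) (w α) with h0' | h1'
      · exact ⟨w, hw, hw0, h0'⟩
      refine ⟨v₀ + w, by rw [mulVec_add, hv₀, hw, add_zero], fun h => hwv ?_, by rw [Pi.add_apply, h1, h1']; decide⟩
      have h2 : ∀ a b : n → ZMod 2, a + b = 0 → b = a := by
        intro a b hab; funext i
        have := congrFun hab i
        rw [Pi.add_apply, Pi.zero_apply] at this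
        have h3 : ∀ x y : ZMod 2, x + y = 0 → y = x := by decide
        exact h3 _ _ this
      exact h2 _ _ h
    refine sum_involution (fun v _ => v + u) (fun v _ => ?_) (fun v _ _ => ?_) (fun v hv => ?_) (fun v _ => ?_)
    · rw [Pi.add_apply, huα, add_zero]
      exact CharTwo.add_self_eq_zero _
    · intro h
      apply hu0
      have := congrFun h
      funext i
      have hi := congrFun h i
      rw [Pi.add_apply] at hi
      have h3 : ∀ x y : ZMod 2, x + y = x → y = 0 := by decide
      exact h3 _ _ hi
    · rw [mem_filter] at hv ⊢
      exact ⟨mem_univ _, by rw [mulVec_add, hv.2, hu, add_zero]⟩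
    · funext i
      rw [Pi.add_apply, Pi.add_apply, add_assoc, CharTwo.add_self_eq_zero, add_zero]

end KerSum



end Summit.BirchSwinnertonDyer.PrintCf2.QFormForest
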